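import Summits.ValiantsHypothesis.ValiantsHypothesis.Theorems.NewtonUnitEquationsTwoProductsRankOneFourLawToric
import Summits.ValiantsHypothesis.ValiantsHypothesis.Theorems.NewtonUnitEquationsTwoProductsPermutationTypeFamily
import Summits.ValiantsHypothesis.ValiantsHypothesis.Theorems.NewtonUnitEquationsTwoProductsPlanarCellBlockMerge
import Summits.ValiantsHypothesis.ValiantsHypothesis.Theorems.NewtonUnitEquationsTwoProductsFormalLogLinearisationDefs

/-!
# R10 `positive-circuit-chart` — DEFINITIONS of the rung `ConfinedTameLaw C` (statement texts = val-idea-37 g0)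

PROVENANCE: the declarations below are lines 43–87 of `pub/ideators/val-idea-37/Sketch.lean` (val-idea-37 g0, crux-ideate OQH on
stmt-ValiantsHypothesis-5906; critic of record val-idea-crit-8 g0, VERDICT #2 PASS-WITH-PRICE; director R275), filed VERBATIM by
val-lit-p3 g16 (R10 prover hand) under merged-desk RULING #317 (2026-08-28 18:15Z) because the card owner's session had closed; the only
change is the namespace (`…PermutationType.R10Defs`, desk's choice) and this header.  The chart lemma `PositiveCircuitChart` of the same
sketch (l.33) is already a theorem: `…PermutationType.R10.positiveCircuitChart_holds` (p651864).
Scope (R275 P3): `ConfinedTameLaw C` is a PROPER POSITIVE SUB-CASE rung of the residual of line `relation_ladder`; nothing here closes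
5906 (`TwoProducts` / `ResidualLawV21` / `PlanarCellBound` remain OPEN); VP ≠ VNP is NOT proved.
-/

noncomputable section
set_option linter.dupNamespace false

namespace Summit.ValiantsHypothesis.ValiantsHypothesis.Theorems.NewtonUnitEquations.TwoProducts.PermutationType.R10Defs
open scoped BigOperators
open MvPolynomial
open Summit.ValiantsHypothesis.ValiantsHypothesis.Theorems.NewtonUnitEquations.TwoProducts.FormalLogLinearisation
open Summit.ValiantsHypothesis.ValiantsHypothesis.Theorems.NewtonUnitEquations.TwoProducts.PlanarCell
open Summit.ValiantsHypothesis.ValiantsHypothesis.Theorems.NewtonUnitEquations.TwoProducts.PermutationType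

variable {m : ℕ}

/-! ## The realised relation lattice of a letter family and its saturation -/

/-- `ℕ`-valued finsupps as `ℤ`-valued ones. -/
def toZ (x : Expo →₀ ℕ) : Expo →₀ ℤ := x.mapRange (fun n : ℕ => (n : ℤ)) (by simp)

/-- The REALISED differences: `msetT a − msetT b` over all additive coincidences of letter tuples. -/
def realisedDiffs (A : Fin m → Finset Expo) : Set (Expo →₀ ℤ) :=
  {z | ∃ a ∈ tuples A, ∃ b ∈ tuples A, ∑ j, a j = ∑ j, b j ∧ z = toZ (msetT a) - toZ (msetT b)}

/-- The realised relation lattice `Λ(A)` (its rank is the «coincidence rank» of the Negative lane; rank one with a datum =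
`RankOneCoincidences`, now a theorem by R9). -/
def relLattice (A : Fin m → Finset Expo) : Submodule ℤ (Expo →₀ ℤ) := Submodule.span ℤ (realisedDiffs A)

/-- Membership in the SATURATION of `Λ(A)`. -/
def InSat (A : Fin m → Finset Expo) (z : Expo →₀ ℤ) : Prop := ∃ k : ℕ, 0 < k ∧ ((k : ℤ) • z) ∈ relLattice A

/-! ## L2 — FULL RELATION SLICING: the sub-case the chart + slicing closes, typed in the `ResidualLawV20` currency -/

/-- LETTER-CONFINEMENT: every coincidence moves only letters of `L` (as multisets).  `L = ∅` is `PermType`. -/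
def LetterConfined (A : Fin m → Finset Expo) (L : Finset Expo) : Prop :=
  ∀ a ∈ tuples A, ∀ b ∈ tuples A, ∑ j, a j = ∑ j, b j → ∀ e ∉ L, msetT a e = msetT b e

/-- FIBRE SPREAD `≤ Δ`: a nonnegative pattern on `L` that is saturation-equivalent to the `L`-part of a tuple multiset has
mass `≤ Δ` (this is the degree of the `λ`-polynomial in the slice function; towers `e, 2e, 4e, …` are exactly what violates it). -/
def FibreSpread (A : Fin m → Finset Expo) (L : Finset Expo) (Δ : ℕ) : Prop :=
  ∀ a ∈ tuples A, ∀ y : Expo →₀ ℕ, y.support ⊆ L →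
    InSat A (toZ y - toZ ((msetT a).filter (· ∈ L))) → (y.sum fun _ k => k) ≤ Δ

/-- The number of relation patterns (= slices) is at most `C(#L + m, m)`. -/
def SliceCountBound : Prop :=
  ∀ (m : ℕ) (A : Fin m → Finset Expo) (L : Finset Expo),
    ((tuples A).image fun a => (msetT a).filter (· ∈ L)).card ≤ (L.card + m).choose m

/-- **The rung this idea proposes (any coincidence rank):** CONFINED (`#L ≤ C·m`) and TAME (fibre spread `≤ (m+2)^C`)
relation lattices obey the per-cell law.  It contains every rank-one family with a bounded datum (R9's class restricted to
spread `≤ poly`), the first rank-two inhabitants `Negative/RankTwoEscapes` (two collinear pairs: `#L = 4`, spread `≤ m`), and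
every «`r` planted relations on `O(m)` letters» family of the Negative lane; it does NOT contain carry towers (F10) or relations
spread over `≫ m` letters — the honest residual after it. -/
def ConfinedTameLaw (C : ℕ) : Prop :=
  ∃ a b : ℕ, ∀ (m t : ℕ), 2 ≤ t → ∀ (u v : Fin m → MvPolynomial (Fin 2) ℂ),
    (∀ j, coeff 0 (u j) = 0 ∧ (u j).support.card ≤ t) → (∀ j, coeff 0 (v j) = 0 ∧ (v j).support.card ≤ t) →
    ∀ L : Finset Expo, L.card ≤ C * m →
      LetterConfined (fun j => (u j).support ∪ (v j).support) L →
      FibreSpread (fun j => (u j).support ∪ (v j).support) L ((m + 2) ^ C) →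
      ∀ (R : Expo → Expo → Prop) (S : Finset Expo), IsCellFamily u v R S → S.card ≤ 2 ^ (a * m) * (t + 2) ^ b


end Summit.ValiantsHypothesis.ValiantsHypothesis.Theorems.NewtonUnitEquations.TwoProducts.PermutationType.R10Defs

end
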